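import Literature.NumberTheory.LFunctions.Zhang2022.DetectorDictShiftDensity
import Literature.NumberTheory.LFunctions.Zhang2022.DetectorShiftAdmissible
import Literature.NumberTheory.LFunctions.Zhang2022.DetectorShiftPSDSharpTwist

/-!
# Zhang (2022), programme F-S3 (cell landau-siegel, sub-cell E / custody G): the two-sided shift form ON THE
# HYPERSURFACE `c₀(b) = Re A₀(b) = 0` — reduction to the jet form, and three exact instances

Y. Zhang, *Discrete mean estimates and the Landau–Siegel zero*, arXiv:2211.02515v1 [Zhang2022LandauSiegel] —
an unrefereed manuscript under adjudication. **WHAT THIS IS NOT: not a claim about Theorems 1–2 of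
arXiv:2211.02515, about Landau–Siegel zeros, or about Parity; nothing here asserts any claim of the manuscript.**
«The programme SEARCHES and TYPES; no claim about Landau–Siegel zeros, Theorems 1–2 of arXiv:2211.02515 or a
repaired Margin232 until a kernel theorem says so.»

Companion to the SHARPNESS theorem `Det.dictShiftPSD_iff_signAdmissible_of_ne` (`DetectorShiftPSDSharpTwist`,
ls-barrier-num): `Det.DictShiftPSD b ↔ Det.SignAdmissible b` for sorted positive triples OFF the hypersurface
`c₀(b) = Re Σ_j W_j(b) = 0`. This file records what happens ON that hypersurface (numerics memo
`HOME/num/num-2/SHARP-B.md` §2, kits j268467 / j268911, ls-num-2 g5):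

* `Det.pi_div_two_mul_dictShift_of_re_atomA0_eq_zero` — by [K1‴] (`Det.dictShift_eq_bulk_add_jets`) the bulk
  term carries the factor `Re A₀(b)`, so for `Re A₀(b) = 0` the two-sided form of a kinked profile is the JET FORM
  `freeEndForm b I (−a₀) + freeEndForm b 0 (−conj a₁) + π·Re crossJet b a₀ a₁ I` in `(a₀, a₁, I) = (G(0), G(1), ∫₀¹G)`
  alone (rank ≤ 3; the cell's exact numerics find it of rank ONE at every algebraic point tested — not claimed here).
* `Det.sum_shiftGlueW_eq_atoms` — the glue-weight sum is not a new atom: `Σ_j W′_j = A_b − e₁A₀ + (e₂/e₃)A_N`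
  (per channel `e₃/b_j² = b_j − e₁ + e₂/b_j`, `b_j` being a root of `t³ − e₁t² + e₂t − e₃`).
* THREE EXACT INSTANCES with `c₀ = 0` (all channel phases `e^{iπ(e₁/2 − b_j)}` are `±i` or `±1`):
  - `b = (2,3,4)` (in the shift box, NOT sign-admissible — `Det.not_signAdmissible_234`):
    `Det.dictShift_234_eq : DictShift (2,3,4) G G′ = −16·‖G 0 − G 1 − 3πi·∫₀¹G‖²` on kinked profiles, hence
    `Det.not_dictShiftPSD_234` (witness `G ≡ 1`, value `−144π²`) — an instance the `c₀ ≠ 0` theorem does not cover;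
  - `b = (1,3,7)` (NOT sign-admissible, outside the box): `Det.dictShift_137_eq : DictShift (1,3,7) G G′ = 2·‖G 0 + G 1‖²`,
    hence **`Det.dictShiftPSD_137 : DictShiftPSD (1,3,7)`** together with `Det.not_signAdmissible_137` — so the proviso
    `c₀(b) ≠ 0` in the sharpness equivalence CANNOT be dropped as stated;
  - `b = (2,4,6)`: `Det.dictShift_246_eq_zero : DictShift (2,4,6) G G′ = 0` for every kinked profile.
Nothing here asserts anything about `L`-functions. 0 facts, 0 sorries.
-/

noncomputable section

open Complex Real ComplexConjugate Set MeasureTheory intervalIntegral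

namespace Literature.NumberTheory.LFunctions.Zhang2022

namespace Det

open Repair

variable {b : Fin 3 → ℝ} {G G' : ℝ → ℂ}

/-! ### Part 1 — the reduction on `Re A₀(b) = 0` and the glue-weight identity -/

/-- **On the hypersurface `c₀(b) = Re A₀(b) = 0` the two-sided form of a kinked profile is the jet form alone**
(`(π/2)·DictShift b G G′ = freeEndForm b I (−a₀) + freeEndForm b 0 (−conj a₁) + π·Re crossJet b a₀ a₁ I`,
`a₀ = G(0)`, `a₁ = G(1)`, `I = ∫₀¹G`): [K1‴] with the bulk coefficient `Re A₀(b) = 0`.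
[cite: Zhang2022LandauSiegel, §4 (4.1); Prop 7.1 p.44 with (8.11)–(8.23); §18 (18.1)] -/
theorem pi_div_two_mul_dictShift_of_re_atomA0_eq_zero (b : Fin 3 → ℝ) (h0 : (atomA0 b).re = 0)
    (hG : KinkedProfile G G') :
    π / 2 * DictShift b G G'
      = freeEndForm b (∫ y in (0:ℝ)..1, G y) (-G 0) + freeEndForm b 0 (-conj (G 1))
        + π * (crossJet b (G 0) (G 1) (∫ y in (0:ℝ)..1, G y)).re := by
  rw [dictShift_eq_bulk_add_jets b hG, h0, zero_mul, zero_add]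

/-- Per channel: `n_j/b_j = b_j − e₁ + (e₂/e₃)·n_j` (`n_j = e₃/b_j`, and `b_j` is a root of `t³ − e₁t² + e₂t − e₃`).
[cite: Zhang2022LandauSiegel, §8 (8.13)–(8.18)] -/
private theorem shiftN_div_eq (hb : ∀ j, b j ≠ 0) (j : Fin 3) :
    ((shiftN b j : ℝ) : ℂ) / (b j : ℂ)
      = (b j : ℂ) - (symE1 b : ℂ) + ((symE2 b / symE3 b : ℝ) : ℂ) * (shiftN b j : ℂ) := by
  have h0 : (b 0 : ℂ) ≠ 0 := by exact_mod_cast hb 0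
  have h1 : (b 1 : ℂ) ≠ 0 := by exact_mod_cast hb 1
  have h2 : (b 2 : ℂ) ≠ 0 := by exact_mod_cast hb 2
  fin_cases j
  all_goals
    simp only [shiftN, symE1, symE2, symE3, Fin.zero_eta, Fin.mk_one, Fin.reduceFinMk, Fin.isValue,
      Matrix.cons_val_zero, Matrix.cons_val_one, Matrix.cons_val_two, Matrix.head_cons, Matrix.tail_cons]
    push_cast
    field_simp
    ring

/-- **The glue-weight sum in the atoms:** `Σ_j W′_j(b) = A_b(b) − e₁(b)·A₀(b) + (e₂(b)/e₃(b))·A_N(b)` for a triple with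
non-zero entries (`W′_j = W_j·n_j/b_j`, `Det.shiftGlueW`). [cite: Zhang2022LandauSiegel, §8 (8.13)–(8.18); §18 (18.1)] -/
theorem sum_shiftGlueW_eq_atoms (hb : ∀ j, b j ≠ 0) :
    (∑ j : Fin 3, shiftGlueW b j)
      = atomAb b - (symE1 b : ℂ) * atomA0 b + ((symE2 b / symE3 b : ℝ) : ℂ) * atomAN b := by
  have h : ∀ j : Fin 3, shiftGlueW b j
      = shiftW b j * (b j : ℂ) - (symE1 b : ℂ) * shiftW b j
        + ((symE2 b / symE3 b : ℝ) : ℂ) * (shiftW b j * (shiftN b j : ℂ)) := by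
    intro j
    rw [shiftGlueW, mul_div_assoc, shiftN_div_eq hb j]
    ring
  simp only [atomA0, atomAb, atomAN, Fin.sum_univ_three, h]
  ring

/-! ### Part 2 — phases: `e^{iπk/2}` at the half-integers met below -/

/-- `e^{iπ/2} = i`. [folklore] -/
private theorem cexp_pi_div_two_mul_I : cexp (π / 2 * I) = I := by
  rw [Complex.exp_mul_I, Complex.cos_pi_div_two, Complex.sin_pi_div_two]; simp

/-- `e^{iπ·(1/2)} = i`. [folklore] -/
private theorem cexp_I_pi_half : cexp (I * π * (1 / 2 : ℂ)) = I := by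
  rw [show I * π * (1 / 2 : ℂ) = π / 2 * I by ring, cexp_pi_div_two_mul_I]

/-- `e^{iπ·3/2} = −i`. [folklore] -/
private theorem cexp_I_pi_three_halves : cexp (I * π * (3 / 2 : ℂ)) = -I := by
  rw [show I * π * (3 / 2 : ℂ) = π * I + π / 2 * I by ring, Complex.exp_add, Complex.exp_pi_mul_I,
    cexp_pi_div_two_mul_I]; ring

/-- `e^{iπ·5/2} = i`. [folklore] -/
private theorem cexp_I_pi_five_halves : cexp (I * π * (5 / 2 : ℂ)) = I := by
  rw [show I * π * (5 / 2 : ℂ) = 2 * π * I + π / 2 * I by ring, Complex.exp_add, Complex.exp_two_pi_mul_I,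
    cexp_pi_div_two_mul_I, one_mul]

/-- `e^{iπ·9/2} = i`. [folklore] -/
private theorem cexp_I_pi_nine_halves : cexp (I * π * (9 / 2 : ℂ)) = I := by
  rw [show I * π * (9 / 2 : ℂ) = ((2:ℕ) : ℂ) * (2 * π * I) + π / 2 * I by push_cast; ring, Complex.exp_add,
    Complex.exp_nat_mul_two_pi_mul_I, cexp_pi_div_two_mul_I, one_mul]

/-- `e^{iπ·11/2} = −i`. [folklore] -/
private theorem cexp_I_pi_eleven_halves : cexp (I * π * (11 / 2 : ℂ)) = -I := by
  rw [show I * π * (11 / 2 : ℂ) = ((2:ℕ) : ℂ) * (2 * π * I) + π * I + π / 2 * I by push_cast; ring,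
    Complex.exp_add, Complex.exp_add, Complex.exp_nat_mul_two_pi_mul_I, Complex.exp_pi_mul_I,
    cexp_pi_div_two_mul_I]; ring

/-- `e^{−iπ·3/2} = i`. [folklore] -/
private theorem cexp_I_pi_neg_three_halves : cexp (I * π * (-(3 / 2) : ℂ)) = I := by
  rw [show I * π * (-(3 / 2) : ℂ) = ((-1:ℤ) : ℂ) * (2 * π * I) + π / 2 * I by push_cast; ring, Complex.exp_add,
    Complex.exp_int_mul_two_pi_mul_I, cexp_pi_div_two_mul_I, one_mul]

/-- `e^{2πi} = 1`. [folklore] -/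
private theorem cexp_I_pi_two : cexp (I * π * (2 : ℂ)) = 1 := by
  rw [show I * π * (2 : ℂ) = 2 * π * I by ring, Complex.exp_two_pi_mul_I]

/-- `e^{4πi} = 1`. [folklore] -/
private theorem cexp_I_pi_four : cexp (I * π * (4 : ℂ)) = 1 := by
  rw [show I * π * (4 : ℂ) = ((2:ℕ) : ℂ) * (2 * π * I) by push_cast; ring, Complex.exp_nat_mul_two_pi_mul_I]

/-- `e^{6πi} = 1`. [folklore] -/
private theorem cexp_I_pi_six : cexp (I * π * (6 : ℂ)) = 1 := by
  rw [show I * π * (6 : ℂ) = ((3:ℕ) : ℂ) * (2 * π * I) by push_cast; ring, Complex.exp_nat_mul_two_pi_mul_I]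

/-! ### Part 3 — the instance `b = (2,3,4)`: in the box, not sign-admissible, `c₀ = 0`, INDEFINITE -/

/-- Channel weights at `(2,3,4)`: `W = (i, 3i, 2i)` (phases `e^{iπ5/2}, e^{iπ3/2}, e^{iπ/2}`, denominators `2, −1, 2`).
[cite: Zhang2022LandauSiegel, proof of Prop 7.1, (7.19)–(7.21)] -/
theorem shiftW_234 : shiftW ![2, 3, 4] = ![I, 3 * I, 2 * I] := by
  funext j
  fin_cases j
  · simp only [shiftW, shiftS, shiftVdm]
    simp only [Fin.zero_eta, Fin.isValue, Matrix.cons_val_zero, Matrix.cons_val_one, Matrix.head_cons,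
      Matrix.cons_val_two, Matrix.tail_cons]
    have h : cexp (I * π * (((3 + 4 - 2) / 2 : ℝ) : ℂ)) = I := by
      rw [show (((3 + 4 - 2) / 2 : ℝ) : ℂ) = 5 / 2 by push_cast; norm_num, cexp_I_pi_five_halves]
    rw [h]
    push_cast
    field_simp
    norm_num
  · simp only [shiftW, shiftS, shiftVdm]
    simp only [Fin.mk_one, Fin.isValue, Matrix.cons_val_zero, Matrix.cons_val_one, Matrix.head_cons,
      Matrix.cons_val_two, Matrix.tail_cons]
    have h : cexp (I * π * (((4 + 2 - 3) / 2 : ℝ) : ℂ)) = -I := by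
      rw [show (((4 + 2 - 3) / 2 : ℝ) : ℂ) = 3 / 2 by push_cast; norm_num, cexp_I_pi_three_halves]
    rw [h]
    push_cast
    field_simp
    norm_num
  · simp only [shiftW, shiftS, shiftVdm]
    simp only [Fin.reduceFinMk, Fin.isValue, Matrix.cons_val_zero, Matrix.cons_val_one, Matrix.head_cons,
      Matrix.cons_val_two, Matrix.tail_cons]
    have h : cexp (I * π * (((2 + 3 - 4) / 2 : ℝ) : ℂ)) = I := by
      rw [show (((2 + 3 - 4) / 2 : ℝ) : ℂ) = 1 / 2 by push_cast; norm_num, cexp_I_pi_half]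
    rw [h]
    push_cast
    field_simp
    norm_num

/-- `A₀(2,3,4) = 6i` — so `c₀(2,3,4) = Re A₀ = 0`. [cite: Zhang2022LandauSiegel, proof of Prop 7.1, (7.19)–(7.21)] -/
theorem atomA0_234 : atomA0 ![2, 3, 4] = 6 * I := by
  simp only [atomA0, Fin.sum_univ_three, shiftW_234, Matrix.cons_val_zero, Matrix.cons_val_one,
    Matrix.cons_val_two, Matrix.head_cons, Matrix.tail_cons]
  ring

/-- `c₀(2,3,4) = 0`: the triple lies ON the hypersurface excluded by the sharpness theorem.
[cite: Zhang2022LandauSiegel, proof of Prop 7.1, (7.19)–(7.21)] -/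
theorem re_atomA0_234 : (atomA0 ![2, 3, 4]).re = 0 := by
  rw [atomA0_234]; simp

/-- `A_b(2,3,4) = 19i`. [cite: Zhang2022LandauSiegel, §8 (8.13)–(8.18)] -/
theorem atomAb_234 : atomAb ![2, 3, 4] = 19 * I := by
  simp only [atomAb, Fin.sum_univ_three, shiftW_234, Matrix.cons_val_zero, Matrix.cons_val_one,
    Matrix.cons_val_two, Matrix.head_cons, Matrix.tail_cons]
  push_cast
  ring

/-- `A_N(2,3,4) = 48i` (`n = (12, 8, 6)`). [cite: Zhang2022LandauSiegel, §8 (8.13)–(8.18)] -/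
theorem atomAN_234 : atomAN ![2, 3, 4] = 48 * I := by
  simp only [atomAN, shiftN, Fin.sum_univ_three, shiftW_234, Matrix.cons_val_zero, Matrix.cons_val_one,
    Matrix.cons_val_two, Matrix.head_cons, Matrix.tail_cons]
  push_cast
  ring

/-- `Σ_j W′_j(2,3,4) = 17i` (`W′ = W·n/b = (6i, 8i, 3i)`). [cite: Zhang2022LandauSiegel, §18 (18.1)] -/
theorem sum_shiftGlueW_234 : (∑ j : Fin 3, shiftGlueW ![2, 3, 4] j) = 17 * I := by
  simp only [shiftGlueW, shiftN, Fin.sum_univ_three, shiftW_234, Matrix.cons_val_zero, Matrix.cons_val_one,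
    Matrix.cons_val_two, Matrix.head_cons, Matrix.tail_cons]
  push_cast
  field_simp
  ring

/-- `c_g(2,3,4) = −e^{iπ·9/2} = −i`. [cite: Zhang2022LandauSiegel, §18 (18.1)] -/
theorem shiftGlue0_234 : shiftGlue0 ![2, 3, 4] = -I := by
  rw [shiftGlue0]
  simp only [Fin.sum_univ_three, Matrix.cons_val_zero, Matrix.cons_val_one, Matrix.cons_val_two,
    Matrix.head_cons, Matrix.tail_cons]
  rw [show ((((2:ℝ) + 3 + 4) / 2 : ℝ) : ℂ) = 9 / 2 by push_cast; norm_num, cexp_I_pi_nine_halves]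

/-- **CLOSED FORM AT `(2,3,4)`: `DictShift (2,3,4) G G′ = −16·‖G(0) − G(1) − 3πi·∫₀¹G‖²`** for every kinked
profile — a NEGATIVE semidefinite rank-one jet form (the cell's exact numerics: `λ_{(2,3,4)} = −16π − 72π³`; values
`−256`, `−1024`, `−144π²` on `e^{−iπy}`, `e^{iπy}`, `1`). [cite: Zhang2022LandauSiegel, §4 (4.1); Prop 7.1 p.44; §18 (18.1)] -/
theorem dictShift_234_eq (hG : KinkedProfile G G') :
    DictShift ![2, 3, 4] G G'
      = -16 * ‖G 0 - G 1 - 3 * π * I * ∫ y in (0:ℝ)..1, G y‖ ^ 2 := by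
  have hπ : (π : ℝ) ≠ 0 := Real.pi_ne_zero
  have h := pi_div_two_mul_dictShift_of_re_atomA0_eq_zero ![2, 3, 4] re_atomA0_234 hG
  rw [freeEndForm, freeEndForm, crossJet, atomA0_234, atomAb_234, atomAN_234, sum_shiftGlueW_234,
    shiftGlue0_234] at h
  simp only [Matrix.cons_val_zero, Matrix.cons_val_one, Matrix.cons_val_two, Matrix.head_cons,
    Matrix.tail_cons] at h
  set a₀ : ℂ := G 0 with ha₀
  set a₁ : ℂ := G 1 with ha₁
  set Ig : ℂ := ∫ y in (0:ℝ)..1, G y with hIg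
  have key : π / 2 * DictShift ![2, 3, 4] G G'
      = π / 2 * (-16 * ‖a₀ - a₁ - 3 * π * I * Ig‖ ^ 2) := by
    rw [h]
    have e1 : ‖a₀ - a₁ - 3 * π * I * Ig‖ ^ 2
        = (a₀.re - a₁.re + 3 * π * Ig.im) ^ 2 + (a₀.im - a₁.im - 3 * π * Ig.re) ^ 2 := by
      rw [Complex.sq_norm, Complex.normSq_apply]
      simp only [Complex.sub_re, Complex.sub_im, Complex.mul_re, Complex.mul_im, Complex.I_re, Complex.I_im,
        Complex.ofReal_re, Complex.ofReal_im, Complex.re_ofNat, Complex.im_ofNat]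
      ring
    have e2 : ‖Ig‖ ^ 2 = Ig.re ^ 2 + Ig.im ^ 2 := by rw [Complex.sq_norm, Complex.normSq_apply]; ring
    have e3 : ‖-a₀‖ ^ 2 = a₀.re ^ 2 + a₀.im ^ 2 := by rw [norm_neg, Complex.sq_norm, Complex.normSq_apply]; ring
    have e4 : ‖-conj a₁‖ ^ 2 = a₁.re ^ 2 + a₁.im ^ 2 := by
      rw [norm_neg, Complex.norm_conj, Complex.sq_norm, Complex.normSq_apply]; ring
    rw [e1, e2, e3, e4, norm_zero]
    simp only [Complex.mul_re, Complex.mul_im, Complex.sub_re, Complex.add_re, Complex.add_im,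
      Complex.neg_re, Complex.neg_im, Complex.conj_re, Complex.conj_im, Complex.I_re, Complex.I_im,
      Complex.ofReal_re, Complex.ofReal_im, Complex.re_ofNat, Complex.im_ofNat, Complex.zero_re, Complex.zero_im]
    ring
  have hπ2 : (π / 2 : ℝ) ≠ 0 := by positivity
  exact mul_left_cancel₀ hπ2 key

/-- The constant profile `G ≡ 1` (derivative `0`) is kinked. [cite: Zhang2022LandauSiegel, Prop 7.1 p.44 with (7.2)] -/
private theorem kinkedProfile_const_one : KinkedProfile (fun _ : ℝ => (1:ℂ)) (fun _ => (0:ℂ)) where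
  cont := continuousOn_const
  hasDeriv := fun x _ => hasDerivWithinAt_const x _ _
  memLp := by simp

/-- **`¬ DictShiftPSD (2,3,4)`** — an in-box, non-sign-admissible triple ON the hypersurface `c₀ = 0` (so NOT an
instance of `dictShiftPSD_iff_signAdmissible_of_ne`): the constant profile `G ≡ 1` has
`DictShift (2,3,4) 1 0 = −16·‖−3πi‖² = −144π² < 0`. [cite: Zhang2022LandauSiegel, §4 (4.1); Prop 7.1 p.44; §18 (18.1)] -/
theorem not_dictShiftPSD_234 : ¬ DictShiftPSD ![2, 3, 4] := by
  intro h
  have h1 := h (fun _ => (1:ℂ)) (fun _ => (0:ℂ)) kinkedProfile_const_one.isH1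
  rw [dictShift_234_eq kinkedProfile_const_one] at h1
  have hI : (∫ _ in (0:ℝ)..1, (1:ℂ)) = 1 := by simp
  rw [hI] at h1
  have hn : ‖(1:ℂ) - 1 - 3 * π * I * 1‖ ^ 2 = 9 * π ^ 2 := by
    rw [sub_self, zero_sub, mul_one, norm_neg, Complex.norm_mul, Complex.norm_I, mul_one, Complex.norm_mul,
      Complex.norm_real, Real.norm_eq_abs, abs_of_pos Real.pi_pos]
    norm_num
    ring
  rw [hn] at h1
  have : (0:ℝ) < π ^ 2 := by positivity
  linarith

/-! ### Part 4 — the instance `b = (1,3,7)`: not sign-admissible, `c₀ = 0`, yet `DictShiftPSD` HOLDS -/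

/-- Channel weights at `(1,3,7)`: `W = (i/12, −3i/8, 7i/24)` (all three phases `= i`, denominators `12, −8, 24`).
[cite: Zhang2022LandauSiegel, proof of Prop 7.1, (7.19)–(7.21)] -/
theorem shiftW_137 : shiftW ![1, 3, 7] = ![I / 12, -(3 * I / 8), 7 * I / 24] := by
  funext j
  fin_cases j
  · simp only [shiftW, shiftS, shiftVdm]
    simp only [Fin.zero_eta, Fin.isValue, Matrix.cons_val_zero, Matrix.cons_val_one, Matrix.head_cons,
      Matrix.cons_val_two, Matrix.tail_cons]
    have h : cexp (I * π * (((3 + 7 - 1) / 2 : ℝ) : ℂ)) = I := by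
      rw [show (((3 + 7 - 1) / 2 : ℝ) : ℂ) = 9 / 2 by push_cast; norm_num, cexp_I_pi_nine_halves]
    rw [h]
    push_cast
    field_simp
    norm_num
  · simp only [shiftW, shiftS, shiftVdm]
    simp only [Fin.mk_one, Fin.isValue, Matrix.cons_val_zero, Matrix.cons_val_one, Matrix.head_cons,
      Matrix.cons_val_two, Matrix.tail_cons]
    have h : cexp (I * π * (((7 + 1 - 3) / 2 : ℝ) : ℂ)) = I := by
      rw [show (((7 + 1 - 3) / 2 : ℝ) : ℂ) = 5 / 2 by push_cast; norm_num, cexp_I_pi_five_halves]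
    rw [h]
    push_cast
    field_simp
    norm_num
  · simp only [shiftW, shiftS, shiftVdm]
    simp only [Fin.reduceFinMk, Fin.isValue, Matrix.cons_val_zero, Matrix.cons_val_one, Matrix.head_cons,
      Matrix.cons_val_two, Matrix.tail_cons]
    have h : cexp (I * π * (((1 + 3 - 7) / 2 : ℝ) : ℂ)) = I := by
      rw [show (((1 + 3 - 7) / 2 : ℝ) : ℂ) = -(3 / 2) by push_cast; norm_num, cexp_I_pi_neg_three_halves]
    rw [h]
    push_cast
    field_simp
    norm_num

/-- `A₀(1,3,7) = 0` (an all-odd triple: the second divided difference of a linear function). [cite: Zhang2022LandauSiegel, proof of Prop 7.1, (7.19)–(7.21)] -/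
theorem atomA0_137 : atomA0 ![1, 3, 7] = 0 := by
  simp only [atomA0, Fin.sum_univ_three, shiftW_137, Matrix.cons_val_zero, Matrix.cons_val_one,
    Matrix.cons_val_two, Matrix.head_cons, Matrix.tail_cons]
  ring

/-- `A_b(1,3,7) = i`. [cite: Zhang2022LandauSiegel, §8 (8.13)–(8.18)] -/
theorem atomAb_137 : atomAb ![1, 3, 7] = I := by
  simp only [atomAb, Fin.sum_univ_three, shiftW_137, Matrix.cons_val_zero, Matrix.cons_val_one,
    Matrix.cons_val_two, Matrix.head_cons, Matrix.tail_cons]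
  push_cast
  ring

/-- `A_N(1,3,7) = 0` (`n = (21, 7, 3)`). [cite: Zhang2022LandauSiegel, §8 (8.13)–(8.18)] -/
theorem atomAN_137 : atomAN ![1, 3, 7] = 0 := by
  simp only [atomAN, shiftN, Fin.sum_univ_three, shiftW_137, Matrix.cons_val_zero, Matrix.cons_val_one,
    Matrix.cons_val_two, Matrix.head_cons, Matrix.tail_cons]
  push_cast
  ring

/-- `Σ_j W′_j(1,3,7) = i`. [cite: Zhang2022LandauSiegel, §18 (18.1)] -/
theorem sum_shiftGlueW_137 : (∑ j : Fin 3, shiftGlueW ![1, 3, 7] j) = I := by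
  simp only [shiftGlueW, shiftN, Fin.sum_univ_three, shiftW_137, Matrix.cons_val_zero, Matrix.cons_val_one,
    Matrix.cons_val_two, Matrix.head_cons, Matrix.tail_cons]
  push_cast
  field_simp
  ring

/-- `c_g(1,3,7) = −e^{iπ·11/2} = i`. [cite: Zhang2022LandauSiegel, §18 (18.1)] -/
theorem shiftGlue0_137 : shiftGlue0 ![1, 3, 7] = I := by
  rw [shiftGlue0]
  simp only [Fin.sum_univ_three, Matrix.cons_val_zero, Matrix.cons_val_one, Matrix.cons_val_two,
    Matrix.head_cons, Matrix.tail_cons]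
  rw [show ((((1:ℝ) + 3 + 7) / 2 : ℝ) : ℂ) = 11 / 2 by push_cast; norm_num, cexp_I_pi_eleven_halves, neg_neg]

/-- **CLOSED FORM AT `(1,3,7)`: `DictShift (1,3,7) G G′ = 2·‖G(0) + G(1)‖²`** for every kinked profile — a
POSITIVE semidefinite rank-one jet form (`λ_{(1,3,7)} = 2π`). [cite: Zhang2022LandauSiegel, §4 (4.1); Prop 7.1 p.44; §18 (18.1)] -/
theorem dictShift_137_eq (hG : KinkedProfile G G') :
    DictShift ![1, 3, 7] G G' = 2 * ‖G 0 + G 1‖ ^ 2 := by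
  have h := pi_div_two_mul_dictShift_of_re_atomA0_eq_zero ![1, 3, 7] (by rw [atomA0_137]; simp) hG
  rw [freeEndForm, freeEndForm, crossJet, atomA0_137, atomAb_137, atomAN_137, sum_shiftGlueW_137,
    shiftGlue0_137] at h
  simp only [Matrix.cons_val_zero, Matrix.cons_val_one, Matrix.cons_val_two, Matrix.head_cons,
    Matrix.tail_cons] at h
  set a₀ : ℂ := G 0 with ha₀
  set a₁ : ℂ := G 1 with ha₁
  set Ig : ℂ := ∫ y in (0:ℝ)..1, G y with hIg
  have key : π / 2 * DictShift ![1, 3, 7] G G' = π / 2 * (2 * ‖a₀ + a₁‖ ^ 2) := by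
    rw [h]
    have e1 : ‖a₀ + a₁‖ ^ 2 = (a₀.re + a₁.re) ^ 2 + (a₀.im + a₁.im) ^ 2 := by
      rw [Complex.sq_norm, Complex.normSq_apply]; simp only [Complex.add_re, Complex.add_im]; ring
    have e3 : ‖-a₀‖ ^ 2 = a₀.re ^ 2 + a₀.im ^ 2 := by rw [norm_neg, Complex.sq_norm, Complex.normSq_apply]; ring
    have e4 : ‖-conj a₁‖ ^ 2 = a₁.re ^ 2 + a₁.im ^ 2 := by
      rw [norm_neg, Complex.norm_conj, Complex.sq_norm, Complex.normSq_apply]; ring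
    rw [e1, e3, e4, norm_zero]
    simp only [Complex.mul_re, Complex.mul_im, Complex.sub_re, Complex.add_re, Complex.add_im,
      Complex.neg_re, Complex.neg_im, Complex.conj_re, Complex.conj_im, Complex.I_re, Complex.I_im,
      Complex.ofReal_re, Complex.ofReal_im, Complex.zero_re, Complex.zero_im, Complex.zero_im]
    ring
  have hπ2 : (π / 2 : ℝ) ≠ 0 := by positivity
  exact mul_left_cancel₀ hπ2 key

/-- **`DictShiftPSD (1,3,7)` HOLDS** (every `H¹` profile; from the kinked closed form by the density theorem
`dictShiftPSD_of_kinked`). [cite: Zhang2022LandauSiegel, §4 (4.1); Prop 7.1 p.44; §18 (18.1)] -/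
theorem dictShiftPSD_137 : DictShiftPSD ![1, 3, 7] :=
  dictShiftPSD_of_kinked fun G H hG => by rw [dictShift_137_eq hG]; positivity

/-- … while `(1,3,7)` is NOT sign-admissible (`3` and `7` are not in one unit gap). [cite: Zhang2022LandauSiegel, §2 Lemma 2.3, (2.13)] -/
theorem not_signAdmissible_137 : ¬ SignAdmissible ![1, 3, 7] := by
  rintro ⟨-, -, -, -, k, hk1, hk2⟩
  simp only [Matrix.cons_val_zero, Matrix.cons_val_one, Matrix.cons_val_two, Matrix.head_cons, Matrix.tail_cons] at hk1 hk2
  linarith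

/-- **The proviso `c₀(b) ≠ 0` of the sharpness equivalence cannot be dropped:** at `b = (1,3,7)` (sorted, positive,
distinct, `c₀ = 0`) the two-sided form is PSD although the triple is not sign-admissible.
[cite: Zhang2022LandauSiegel, §2 Lemma 2.3; §4 (4.1); §18 (18.1)] -/
theorem dictShiftPSD_and_not_signAdmissible_137 :
    DictShiftPSD ![1, 3, 7] ∧ ¬ SignAdmissible ![1, 3, 7] ∧ (atomA0 ![1, 3, 7]).re = 0 :=
  ⟨dictShiftPSD_137, not_signAdmissible_137, by rw [atomA0_137]; simp⟩

/-! ### Part 5 — the instance `b = (2,4,6)`: the two-sided form VANISHES identically -/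

/-- Channel weights at `(2,4,6)`: `W = (1/4, −1, 3/4)` (phases `e^{4πi}, e^{2πi}, e^{0}` all `= 1`).
[cite: Zhang2022LandauSiegel, proof of Prop 7.1, (7.19)–(7.21)] -/
theorem shiftW_246 : shiftW ![2, 4, 6] = ![1 / 4, -1, 3 / 4] := by
  funext j
  fin_cases j
  · simp only [shiftW, shiftS, shiftVdm]
    simp only [Fin.zero_eta, Fin.isValue, Matrix.cons_val_zero, Matrix.cons_val_one, Matrix.head_cons,
      Matrix.cons_val_two, Matrix.tail_cons]
    have h : cexp (I * π * (((4 + 6 - 2) / 2 : ℝ) : ℂ)) = 1 := by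
      rw [show (((4 + 6 - 2) / 2 : ℝ) : ℂ) = 4 by push_cast; norm_num, cexp_I_pi_four]
    rw [h]
    push_cast
    norm_num
  · simp only [shiftW, shiftS, shiftVdm]
    simp only [Fin.mk_one, Fin.isValue, Matrix.cons_val_zero, Matrix.cons_val_one, Matrix.head_cons,
      Matrix.cons_val_two, Matrix.tail_cons]
    have h : cexp (I * π * (((6 + 2 - 4) / 2 : ℝ) : ℂ)) = 1 := by
      rw [show (((6 + 2 - 4) / 2 : ℝ) : ℂ) = 2 by push_cast; norm_num, cexp_I_pi_two]
    rw [h]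
    push_cast
    norm_num
  · simp only [shiftW, shiftS, shiftVdm]
    simp only [Fin.reduceFinMk, Fin.isValue, Matrix.cons_val_zero, Matrix.cons_val_one, Matrix.head_cons,
      Matrix.cons_val_two, Matrix.tail_cons]
    have h : cexp (I * π * (((2 + 4 - 6) / 2 : ℝ) : ℂ)) = 1 := by
      rw [show (((2 + 4 - 6) / 2 : ℝ) : ℂ) = 0 by push_cast; norm_num, mul_zero, Complex.exp_zero]
    rw [h]
    push_cast
    norm_num

/-- `A₀(2,4,6) = 0`. [cite: Zhang2022LandauSiegel, proof of Prop 7.1, (7.19)–(7.21)] -/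
theorem atomA0_246 : atomA0 ![2, 4, 6] = 0 := by
  simp only [atomA0, Fin.sum_univ_three, shiftW_246, Matrix.cons_val_zero, Matrix.cons_val_one,
    Matrix.cons_val_two, Matrix.head_cons, Matrix.tail_cons]
  norm_num

/-- `A_b(2,4,6) = 1`. [cite: Zhang2022LandauSiegel, §8 (8.13)–(8.18)] -/
theorem atomAb_246 : atomAb ![2, 4, 6] = 1 := by
  simp only [atomAb, Fin.sum_univ_three, shiftW_246, Matrix.cons_val_zero, Matrix.cons_val_one,
    Matrix.cons_val_two, Matrix.head_cons, Matrix.tail_cons]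
  push_cast
  norm_num

/-- `A_N(2,4,6) = 0` (`n = (24, 12, 8)`). [cite: Zhang2022LandauSiegel, §8 (8.13)–(8.18)] -/
theorem atomAN_246 : atomAN ![2, 4, 6] = 0 := by
  simp only [atomAN, shiftN, Fin.sum_univ_three, shiftW_246, Matrix.cons_val_zero, Matrix.cons_val_one,
    Matrix.cons_val_two, Matrix.head_cons, Matrix.tail_cons]
  push_cast
  norm_num

/-- `Σ_j W′_j(2,4,6) = 1`. [cite: Zhang2022LandauSiegel, §18 (18.1)] -/
theorem sum_shiftGlueW_246 : (∑ j : Fin 3, shiftGlueW ![2, 4, 6] j) = 1 := by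
  simp only [shiftGlueW, shiftN, Fin.sum_univ_three, shiftW_246, Matrix.cons_val_zero, Matrix.cons_val_one,
    Matrix.cons_val_two, Matrix.head_cons, Matrix.tail_cons]
  push_cast
  norm_num

/-- `c_g(2,4,6) = −e^{6πi} = −1`. [cite: Zhang2022LandauSiegel, §18 (18.1)] -/
theorem shiftGlue0_246 : shiftGlue0 ![2, 4, 6] = -1 := by
  rw [shiftGlue0]
  simp only [Fin.sum_univ_three, Matrix.cons_val_zero, Matrix.cons_val_one, Matrix.cons_val_two,
    Matrix.head_cons, Matrix.tail_cons]
  rw [show ((((2:ℝ) + 4 + 6) / 2 : ℝ) : ℂ) = 6 by push_cast; norm_num, cexp_I_pi_six]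

/-- **AT `(2,4,6)` THE TWO-SIDED FORM VANISHES IDENTICALLY** on kinked profiles (`A₀ = A_N = 0`, `A_b` real,
`ΣW′ + c_g = 0`: the jet form is `0`). [cite: Zhang2022LandauSiegel, §4 (4.1); Prop 7.1 p.44; §18 (18.1)] -/
theorem dictShift_246_eq_zero (hG : KinkedProfile G G') : DictShift ![2, 4, 6] G G' = 0 := by
  have h := pi_div_two_mul_dictShift_of_re_atomA0_eq_zero ![2, 4, 6] (by rw [atomA0_246]; simp) hG
  rw [freeEndForm, freeEndForm, crossJet, atomA0_246, atomAb_246, atomAN_246, sum_shiftGlueW_246,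
    shiftGlue0_246] at h
  simp only [Complex.zero_im, Complex.one_im, zero_div, neg_zero, zero_mul, mul_zero, add_zero,
    sub_zero, add_neg_cancel, Complex.zero_re] at h
  have hπ2 : (π / 2 : ℝ) ≠ 0 := by positivity
  have : π / 2 * DictShift ![2, 4, 6] G G' = π / 2 * 0 := by rw [h, mul_zero]
  exact mul_left_cancel₀ hπ2 this

/-- So `DictShiftPSD (2,4,6)` holds trivially, and `(2,4,6)` is not sign-admissible either.
[cite: Zhang2022LandauSiegel, §2 Lemma 2.3; §4 (4.1); §18 (18.1)] -/
theorem dictShiftPSD_and_not_signAdmissible_246 : DictShiftPSD ![2, 4, 6] ∧ ¬ SignAdmissible ![2, 4, 6] := by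
  refine ⟨dictShiftPSD_of_kinked fun G H hG => by rw [dictShift_246_eq_zero hG], ?_⟩
  rintro ⟨-, -, -, -, k, hk1, hk2⟩
  simp only [Matrix.cons_val_zero, Matrix.cons_val_one, Matrix.cons_val_two, Matrix.head_cons, Matrix.tail_cons] at hk1 hk2
  have hk : (k : ℝ) ≤ 4 := hk1
  have hk' : (6 : ℝ) ≤ k + 1 := hk2
  have h5 : (5 : ℝ) ≤ k := by linarith
  linarith


/-! ### Part 6 (append) — the instance `b = (1,2,4)`: in the box, not sign-admissible, `c₀ = 0`, INDEFINITE -/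

/-- `e^{iπ·7/2} = −i`. [folklore] -/
private theorem cexp_I_pi_seven_halves : cexp (I * π * (7 / 2 : ℂ)) = -I := by
  rw [show I * π * (7 / 2 : ℂ) = 2 * π * I + π * I + π / 2 * I by ring, Complex.exp_add, Complex.exp_add,
    Complex.exp_two_pi_mul_I, Complex.exp_pi_mul_I, cexp_pi_div_two_mul_I]; ring

/-- `e^{−iπ/2} = −i`. [folklore] -/
private theorem cexp_I_pi_neg_half : cexp (I * π * (-(1 / 2) : ℂ)) = -I := by
  rw [show I * π * (-(1 / 2) : ℂ) = -(π / 2 * I) by ring, Complex.exp_neg, cexp_pi_div_two_mul_I, Complex.inv_I]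

/-- Channel weights at `(1,2,4)`: `W = (i/3, i, −2i/3)` (phases `e^{iπ5/2}, e^{iπ3/2}, e^{−iπ/2}`, denominators `3, −2, 6`).
[cite: Zhang2022LandauSiegel, proof of Prop 7.1, (7.19)–(7.21)] -/
theorem shiftW_124 : shiftW ![1, 2, 4] = ![I / 3, I, -(2 * I / 3)] := by
  funext j
  fin_cases j
  · simp only [shiftW, shiftS, shiftVdm]
    simp only [Fin.zero_eta, Fin.isValue, Matrix.cons_val_zero, Matrix.cons_val_one, Matrix.head_cons,
      Matrix.cons_val_two, Matrix.tail_cons]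
    have h : cexp (I * π * (((2 + 4 - 1) / 2 : ℝ) : ℂ)) = I := by
      rw [show (((2 + 4 - 1) / 2 : ℝ) : ℂ) = 5 / 2 by push_cast; norm_num, cexp_I_pi_five_halves]
    rw [h]
    push_cast
    field_simp
    norm_num
  · simp only [shiftW, shiftS, shiftVdm]
    simp only [Fin.mk_one, Fin.isValue, Matrix.cons_val_zero, Matrix.cons_val_one, Matrix.head_cons,
      Matrix.cons_val_two, Matrix.tail_cons]
    have h : cexp (I * π * (((4 + 1 - 2) / 2 : ℝ) : ℂ)) = -I := by
      rw [show (((4 + 1 - 2) / 2 : ℝ) : ℂ) = 3 / 2 by push_cast; norm_num, cexp_I_pi_three_halves]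
    rw [h]
    push_cast
    field_simp
    norm_num
  · simp only [shiftW, shiftS, shiftVdm]
    simp only [Fin.reduceFinMk, Fin.isValue, Matrix.cons_val_zero, Matrix.cons_val_one, Matrix.head_cons,
      Matrix.cons_val_two, Matrix.tail_cons]
    have h : cexp (I * π * (((1 + 2 - 4) / 2 : ℝ) : ℂ)) = -I := by
      rw [show (((1 + 2 - 4) / 2 : ℝ) : ℂ) = -(1 / 2) by push_cast; norm_num, cexp_I_pi_neg_half]
    rw [h]
    push_cast
    field_simp
    norm_num

/-- `A₀(1,2,4) = 2i/3` (so `c₀ = 0`). [cite: Zhang2022LandauSiegel, proof of Prop 7.1, (7.19)–(7.21)] -/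
theorem atomA0_124 : atomA0 ![1, 2, 4] = 2 * I / 3 := by
  simp only [atomA0, Fin.sum_univ_three, shiftW_124, Matrix.cons_val_zero, Matrix.cons_val_one,
    Matrix.cons_val_two, Matrix.head_cons, Matrix.tail_cons]
  ring

/-- `A_b(1,2,4) = −i/3`. [cite: Zhang2022LandauSiegel, §8 (8.13)–(8.18)] -/
theorem atomAb_124 : atomAb ![1, 2, 4] = -(I / 3) := by
  simp only [atomAb, Fin.sum_univ_three, shiftW_124, Matrix.cons_val_zero, Matrix.cons_val_one,
    Matrix.cons_val_two, Matrix.head_cons, Matrix.tail_cons]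
  push_cast
  ring

/-- `A_N(1,2,4) = 16i/3` (`n = (8, 4, 2)`). [cite: Zhang2022LandauSiegel, §8 (8.13)–(8.18)] -/
theorem atomAN_124 : atomAN ![1, 2, 4] = 16 * I / 3 := by
  simp only [atomAN, shiftN, Fin.sum_univ_three, shiftW_124, Matrix.cons_val_zero, Matrix.cons_val_one,
    Matrix.cons_val_two, Matrix.head_cons, Matrix.tail_cons]
  push_cast
  ring

/-- `Σ_j W′_j(1,2,4) = 13i/3`. [cite: Zhang2022LandauSiegel, §18 (18.1)] -/
theorem sum_shiftGlueW_124 : (∑ j : Fin 3, shiftGlueW ![1, 2, 4] j) = 13 * I / 3 := by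
  simp only [shiftGlueW, shiftN, Fin.sum_univ_three, shiftW_124, Matrix.cons_val_zero, Matrix.cons_val_one,
    Matrix.cons_val_two, Matrix.head_cons, Matrix.tail_cons]
  push_cast
  field_simp
  ring

/-- `c_g(1,2,4) = −e^{iπ·7/2} = i`. [cite: Zhang2022LandauSiegel, §18 (18.1)] -/
theorem shiftGlue0_124 : shiftGlue0 ![1, 2, 4] = I := by
  rw [shiftGlue0]
  simp only [Fin.sum_univ_three, Matrix.cons_val_zero, Matrix.cons_val_one, Matrix.cons_val_two,
    Matrix.head_cons, Matrix.tail_cons]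
  rw [show ((((1:ℝ) + 2 + 4) / 2 : ℝ) : ℂ) = 7 / 2 by push_cast; norm_num, cexp_I_pi_seven_halves, neg_neg]

/-- **CLOSED FORM AT `(1,2,4)`: `DictShift (1,2,4) G G′ = −(16/3)·‖G(0) − G(1) − πi·∫₀¹G‖²`** for every kinked
profile — a NEGATIVE semidefinite rank-one jet form (`λ_{(1,2,4)} = −16π/3 − 8π³/3`; value `−256/3` on `e^{iπy}`).
[cite: Zhang2022LandauSiegel, §4 (4.1); Prop 7.1 p.44; §18 (18.1)] -/
theorem dictShift_124_eq (hG : KinkedProfile G G') :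
    DictShift ![1, 2, 4] G G'
      = -(16 / 3) * ‖G 0 - G 1 - π * I * ∫ y in (0:ℝ)..1, G y‖ ^ 2 := by
  have h := pi_div_two_mul_dictShift_of_re_atomA0_eq_zero ![1, 2, 4] (by rw [atomA0_124]; simp) hG
  rw [freeEndForm, freeEndForm, crossJet, atomA0_124, atomAb_124, atomAN_124, sum_shiftGlueW_124,
    shiftGlue0_124] at h
  simp only [Matrix.cons_val_zero, Matrix.cons_val_one, Matrix.cons_val_two, Matrix.head_cons,
    Matrix.tail_cons] at h
  set a₀ : ℂ := G 0 with ha₀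
  set a₁ : ℂ := G 1 with ha₁
  set Ig : ℂ := ∫ y in (0:ℝ)..1, G y with hIg
  have key : π / 2 * DictShift ![1, 2, 4] G G'
      = π / 2 * (-(16 / 3) * ‖a₀ - a₁ - π * I * Ig‖ ^ 2) := by
    rw [h]
    have e1 : ‖a₀ - a₁ - π * I * Ig‖ ^ 2
        = (a₀.re - a₁.re + π * Ig.im) ^ 2 + (a₀.im - a₁.im - π * Ig.re) ^ 2 := by
      rw [Complex.sq_norm, Complex.normSq_apply]
      simp only [Complex.sub_re, Complex.sub_im, Complex.mul_re, Complex.mul_im, Complex.I_re, Complex.I_im,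
        Complex.ofReal_re, Complex.ofReal_im]
      ring
    have e2 : ‖Ig‖ ^ 2 = Ig.re ^ 2 + Ig.im ^ 2 := by rw [Complex.sq_norm, Complex.normSq_apply]; ring
    have e3 : ‖-a₀‖ ^ 2 = a₀.re ^ 2 + a₀.im ^ 2 := by rw [norm_neg, Complex.sq_norm, Complex.normSq_apply]; ring
    have e4 : ‖-conj a₁‖ ^ 2 = a₁.re ^ 2 + a₁.im ^ 2 := by
      rw [norm_neg, Complex.norm_conj, Complex.sq_norm, Complex.normSq_apply]; ring
    rw [e1, e2, e3, e4, norm_zero]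
    simp only [Complex.mul_re, Complex.mul_im, Complex.sub_re, Complex.add_re, Complex.add_im,
      Complex.neg_re, Complex.neg_im, Complex.conj_re, Complex.conj_im, Complex.I_re, Complex.I_im,
      Complex.ofReal_re, Complex.ofReal_im, Complex.re_ofNat, Complex.im_ofNat, Complex.zero_re, Complex.zero_im,
      Complex.div_re, Complex.div_im, Complex.normSq_ofNat]
    ring
  have hπ2 : (π / 2 : ℝ) ≠ 0 := by positivity
  exact mul_left_cancel₀ hπ2 key

/-- **`¬ DictShiftPSD (1,2,4)`** (in-box, `c₀ = 0`, not sign-admissible — `Det.not_signAdmissible_124`): the constant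
profile `G ≡ 1` has `DictShift (1,2,4) 1 0 = −(16/3)·π² < 0`. [cite: Zhang2022LandauSiegel, §4 (4.1); Prop 7.1 p.44; §18 (18.1)] -/
theorem not_dictShiftPSD_124 : ¬ DictShiftPSD ![1, 2, 4] := by
  intro h
  have h1 := h (fun _ => (1:ℂ)) (fun _ => (0:ℂ)) kinkedProfile_const_one.isH1
  rw [dictShift_124_eq kinkedProfile_const_one] at h1
  have hI : (∫ _ in (0:ℝ)..1, (1:ℂ)) = 1 := by simp
  rw [hI] at h1
  have hn : ‖(1:ℂ) - 1 - π * I * 1‖ ^ 2 = π ^ 2 := by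
    rw [sub_self, zero_sub, mul_one, norm_neg, Complex.norm_mul, Complex.norm_I, mul_one, Complex.norm_real,
      Real.norm_eq_abs, abs_of_pos Real.pi_pos]
  rw [hn] at h1
  have : (0:ℝ) < π ^ 2 := by positivity
  linarith

/-! ### Part 7 (append) — the instance `b = (1,3,5)` (box boundary `b₂ = 5`): `DictShift = −2‖G 0 + G 1‖²` -/

/-- Channel weights at `(1,3,5)`: `W = (−i/8, 3i/4, −5i/8)` (all three phases `= −i`, denominators `8, −4, 8`).
[cite: Zhang2022LandauSiegel, proof of Prop 7.1, (7.19)–(7.21)] -/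
theorem shiftW_135 : shiftW ![1, 3, 5] = ![-(I / 8), 3 * I / 4, -(5 * I / 8)] := by
  funext j
  fin_cases j
  · simp only [shiftW, shiftS, shiftVdm]
    simp only [Fin.zero_eta, Fin.isValue, Matrix.cons_val_zero, Matrix.cons_val_one, Matrix.head_cons,
      Matrix.cons_val_two, Matrix.tail_cons]
    have h : cexp (I * π * (((3 + 5 - 1) / 2 : ℝ) : ℂ)) = -I := by
      rw [show (((3 + 5 - 1) / 2 : ℝ) : ℂ) = 7 / 2 by push_cast; norm_num, cexp_I_pi_seven_halves]
    rw [h]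
    push_cast
    field_simp
    norm_num
  · simp only [shiftW, shiftS, shiftVdm]
    simp only [Fin.mk_one, Fin.isValue, Matrix.cons_val_zero, Matrix.cons_val_one, Matrix.head_cons,
      Matrix.cons_val_two, Matrix.tail_cons]
    have h : cexp (I * π * (((5 + 1 - 3) / 2 : ℝ) : ℂ)) = -I := by
      rw [show (((5 + 1 - 3) / 2 : ℝ) : ℂ) = 3 / 2 by push_cast; norm_num, cexp_I_pi_three_halves]
    rw [h]
    push_cast
    field_simp
    norm_num
  · simp only [shiftW, shiftS, shiftVdm]
    simp only [Fin.reduceFinMk, Fin.isValue, Matrix.cons_val_zero, Matrix.cons_val_one, Matrix.head_cons,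
      Matrix.cons_val_two, Matrix.tail_cons]
    have h : cexp (I * π * (((1 + 3 - 5) / 2 : ℝ) : ℂ)) = -I := by
      rw [show (((1 + 3 - 5) / 2 : ℝ) : ℂ) = -(1 / 2) by push_cast; norm_num, cexp_I_pi_neg_half]
    rw [h]
    push_cast
    field_simp
    norm_num

/-- `A₀(1,3,5) = 0`. [cite: Zhang2022LandauSiegel, proof of Prop 7.1, (7.19)–(7.21)] -/
theorem atomA0_135 : atomA0 ![1, 3, 5] = 0 := by
  simp only [atomA0, Fin.sum_univ_three, shiftW_135, Matrix.cons_val_zero, Matrix.cons_val_one,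
    Matrix.cons_val_two, Matrix.head_cons, Matrix.tail_cons]
  ring

/-- `A_b(1,3,5) = −i`. [cite: Zhang2022LandauSiegel, §8 (8.13)–(8.18)] -/
theorem atomAb_135 : atomAb ![1, 3, 5] = -I := by
  simp only [atomAb, Fin.sum_univ_three, shiftW_135, Matrix.cons_val_zero, Matrix.cons_val_one,
    Matrix.cons_val_two, Matrix.head_cons, Matrix.tail_cons]
  push_cast
  ring

/-- `A_N(1,3,5) = 0` (`n = (15, 5, 3)`). [cite: Zhang2022LandauSiegel, §8 (8.13)–(8.18)] -/
theorem atomAN_135 : atomAN ![1, 3, 5] = 0 := by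
  simp only [atomAN, shiftN, Fin.sum_univ_three, shiftW_135, Matrix.cons_val_zero, Matrix.cons_val_one,
    Matrix.cons_val_two, Matrix.head_cons, Matrix.tail_cons]
  push_cast
  ring

/-- `Σ_j W′_j(1,3,5) = −i`. [cite: Zhang2022LandauSiegel, §18 (18.1)] -/
theorem sum_shiftGlueW_135 : (∑ j : Fin 3, shiftGlueW ![1, 3, 5] j) = -I := by
  simp only [shiftGlueW, shiftN, Fin.sum_univ_three, shiftW_135, Matrix.cons_val_zero, Matrix.cons_val_one,
    Matrix.cons_val_two, Matrix.head_cons, Matrix.tail_cons]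
  push_cast
  field_simp
  ring

/-- `c_g(1,3,5) = −e^{iπ·9/2} = −i`. [cite: Zhang2022LandauSiegel, §18 (18.1)] -/
theorem shiftGlue0_135 : shiftGlue0 ![1, 3, 5] = -I := by
  rw [shiftGlue0]
  simp only [Fin.sum_univ_three, Matrix.cons_val_zero, Matrix.cons_val_one, Matrix.cons_val_two,
    Matrix.head_cons, Matrix.tail_cons]
  rw [show ((((1:ℝ) + 3 + 5) / 2 : ℝ) : ℂ) = 9 / 2 by push_cast; norm_num, cexp_I_pi_nine_halves]

/-- **CLOSED FORM AT `(1,3,5)`: `DictShift (1,3,5) G G′ = −2·‖G(0) + G(1)‖²`** for every kinked profile (the all-odd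
triple with `κ = −1`; compare `(1,3,7)` with `κ = +1`). [cite: Zhang2022LandauSiegel, §4 (4.1); Prop 7.1 p.44; §18 (18.1)] -/
theorem dictShift_135_eq (hG : KinkedProfile G G') :
    DictShift ![1, 3, 5] G G' = -2 * ‖G 0 + G 1‖ ^ 2 := by
  have h := pi_div_two_mul_dictShift_of_re_atomA0_eq_zero ![1, 3, 5] (by rw [atomA0_135]; simp) hG
  rw [freeEndForm, freeEndForm, crossJet, atomA0_135, atomAb_135, atomAN_135, sum_shiftGlueW_135,
    shiftGlue0_135] at h
  simp only [Matrix.cons_val_zero, Matrix.cons_val_one, Matrix.cons_val_two, Matrix.head_cons,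
    Matrix.tail_cons] at h
  set a₀ : ℂ := G 0 with ha₀
  set a₁ : ℂ := G 1 with ha₁
  set Ig : ℂ := ∫ y in (0:ℝ)..1, G y with hIg
  have key : π / 2 * DictShift ![1, 3, 5] G G' = π / 2 * (-2 * ‖a₀ + a₁‖ ^ 2) := by
    rw [h]
    have e1 : ‖a₀ + a₁‖ ^ 2 = (a₀.re + a₁.re) ^ 2 + (a₀.im + a₁.im) ^ 2 := by
      rw [Complex.sq_norm, Complex.normSq_apply]; simp only [Complex.add_re, Complex.add_im]; ring
    have e3 : ‖-a₀‖ ^ 2 = a₀.re ^ 2 + a₀.im ^ 2 := by rw [norm_neg, Complex.sq_norm, Complex.normSq_apply]; ring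
    have e4 : ‖-conj a₁‖ ^ 2 = a₁.re ^ 2 + a₁.im ^ 2 := by
      rw [norm_neg, Complex.norm_conj, Complex.sq_norm, Complex.normSq_apply]; ring
    rw [e1, e3, e4, norm_zero]
    simp only [Complex.mul_re, Complex.mul_im, Complex.sub_re, Complex.add_re, Complex.add_im,
      Complex.neg_re, Complex.neg_im, Complex.conj_re, Complex.conj_im, Complex.I_re, Complex.I_im,
      Complex.ofReal_re, Complex.ofReal_im, Complex.zero_re, Complex.zero_im]
    ring
  have hπ2 : (π / 2 : ℝ) ≠ 0 := by positivity
  exact mul_left_cancel₀ hπ2 key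

/-- **`¬ DictShiftPSD (1,3,5)`** (witness `G ≡ 1`: value `−8`); `(1,3,5)` is not sign-admissible and sits on the boundary
`b₂ = 5` of the shift box. [cite: Zhang2022LandauSiegel, §4 (4.1); Prop 7.1 p.44; §18 (18.1)] -/
theorem not_dictShiftPSD_135 : ¬ DictShiftPSD ![1, 3, 5] := by
  intro h
  have h1 := h (fun _ => (1:ℂ)) (fun _ => (0:ℂ)) kinkedProfile_const_one.isH1
  rw [dictShift_135_eq kinkedProfile_const_one] at h1
  norm_num at h1


/-! ### Part 8 (append) — the third named non-admissible instance `b = (3/2,5/2,7/2)`: `c₀ = 5cos(π/4) > 0`, so the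
`c₀ ≠ 0` iff of record applies (lifted from ls-barrier-ref g5's probe BM, HOME/ls-barrier-ref/probeBM-threeHalves-c0.lean) -/

/-- `e^{iπ(r+2)} = e^{iπr}`. [folklore] -/
private theorem cexp_I_pi_add_two (r : ℂ) : cexp (I * π * (r + 2)) = cexp (I * π * r) := by
  rw [show I * π * (r + 2) = I * π * r + 2 * π * I by ring, Complex.exp_add, Complex.exp_two_pi_mul_I, mul_one]

/-- `e^{iπ(r+1)} = −e^{iπr}`. [folklore] -/
private theorem cexp_I_pi_add_one (r : ℂ) : cexp (I * π * (r + 1)) = -cexp (I * π * r) := by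
  rw [show I * π * (r + 1) = I * π * r + π * I by ring, Complex.exp_add, Complex.exp_pi_mul_I, mul_neg_one]

/-- Channel weights at `(3/2,5/2,7/2)`: `W = (3/4, 5/2, 7/4)·e^{iπ/4}` (phases `e^{iπ9/4}, e^{iπ5/4}, e^{iπ/4}`,
denominators `2, −1, 2`). [cite: Zhang2022LandauSiegel, proof of Prop 7.1, (7.19)–(7.21)] -/
theorem shiftW_threeHalves : shiftW ![3 / 2, 5 / 2, 7 / 2]
    = ![3 / 4 * cexp (I * π * (1 / 4 : ℂ)), 5 / 2 * cexp (I * π * (1 / 4 : ℂ)), 7 / 4 * cexp (I * π * (1 / 4 : ℂ))] := by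
  funext j
  fin_cases j
  · simp only [shiftW, shiftS, shiftVdm]
    simp only [Fin.zero_eta, Fin.isValue, Matrix.cons_val_zero, Matrix.cons_val_one, Matrix.head_cons,
      Matrix.cons_val_two, Matrix.tail_cons]
    have h : cexp (I * π * ((((5:ℝ) / 2 + 7 / 2 - 3 / 2) / 2 : ℝ) : ℂ)) = cexp (I * π * (1 / 4 : ℂ)) := by
      rw [show ((((5:ℝ) / 2 + 7 / 2 - 3 / 2) / 2 : ℝ) : ℂ) = (1 / 4 : ℂ) + 2 by push_cast; norm_num, cexp_I_pi_add_two]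
    rw [h]
    push_cast
    field_simp
    ring
  · simp only [shiftW, shiftS, shiftVdm]
    simp only [Fin.mk_one, Fin.isValue, Matrix.cons_val_zero, Matrix.cons_val_one, Matrix.head_cons,
      Matrix.cons_val_two, Matrix.tail_cons]
    have h : cexp (I * π * ((((7:ℝ) / 2 + 3 / 2 - 5 / 2) / 2 : ℝ) : ℂ)) = -cexp (I * π * (1 / 4 : ℂ)) := by
      rw [show ((((7:ℝ) / 2 + 3 / 2 - 5 / 2) / 2 : ℝ) : ℂ) = (1 / 4 : ℂ) + 1 by push_cast; norm_num, cexp_I_pi_add_one]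
    rw [h]
    push_cast
    field_simp
    ring
  · simp only [shiftW, shiftS, shiftVdm]
    simp only [Fin.reduceFinMk, Fin.isValue, Matrix.cons_val_zero, Matrix.cons_val_one, Matrix.head_cons,
      Matrix.cons_val_two, Matrix.tail_cons]
    have h : cexp (I * π * ((((3:ℝ) / 2 + 5 / 2 - 7 / 2) / 2 : ℝ) : ℂ)) = cexp (I * π * (1 / 4 : ℂ)) := by
      rw [show ((((3:ℝ) / 2 + 5 / 2 - 7 / 2) / 2 : ℝ) : ℂ) = (1 / 4 : ℂ) by push_cast; norm_num]
    rw [h]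
    push_cast
    field_simp
    ring

/-- `A₀(3/2,5/2,7/2) = 5·e^{iπ/4}`. [cite: Zhang2022LandauSiegel, proof of Prop 7.1, (7.19)–(7.21)] -/
theorem atomA0_threeHalves : atomA0 ![3 / 2, 5 / 2, 7 / 2] = 5 * cexp (I * π * (1 / 4 : ℂ)) := by
  simp only [atomA0, Fin.sum_univ_three, shiftW_threeHalves, Matrix.cons_val_zero, Matrix.cons_val_one,
    Matrix.cons_val_two, Matrix.head_cons, Matrix.tail_cons]
  ring

/-- **`c₀(3/2,5/2,7/2) = 5cos(π/4) > 0`** — the triple is OFF the hypersurface, so the sharpness iff of record applies to it.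
[cite: Zhang2022LandauSiegel, proof of Prop 7.1, (7.19)–(7.21)] -/
theorem re_atomA0_threeHalves_pos : 0 < (atomA0 ![3 / 2, 5 / 2, 7 / 2]).re := by
  rw [atomA0_threeHalves]
  have hre : (I * π * (1 / 4 : ℂ)).re = 0 := by simp
  have him : (I * π * (1 / 4 : ℂ)).im = π / 4 := by simp; ring
  have h : (5 * cexp (I * π * (1 / 4 : ℂ))).re = 5 * Real.cos (π / 4) := by
    rw [Complex.mul_re, Complex.exp_re, Complex.exp_im, hre, him, Real.exp_zero, one_mul, one_mul]
    norm_num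
  rw [h, Real.cos_pi_div_four]
  positivity

/-- **`¬ DictShiftPSD (3/2,5/2,7/2)`** — the third named non-admissible instance of `DetectorShiftAdmissible`
(`Det.not_signAdmissible_threeHalves`: no sub-first-gap shift), through the `c₀ ≠ 0` sharpness iff of record
`Det.dictShiftPSD_iff_signAdmissible_of_ne`. [cite: Zhang2022LandauSiegel, §2 Lemma 2.3; §4 (4.1); §18 (18.1)] -/
theorem not_dictShiftPSD_threeHalves : ¬ DictShiftPSD ![3 / 2, 5 / 2, 7 / 2] := by
  intro h
  have hc : (∑ j : Fin 3, shiftW ![(3:ℝ) / 2, 5 / 2, 7 / 2] j).re ≠ 0 := by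
    have := re_atomA0_threeHalves_pos
    simp only [atomA0] at this
    exact ne_of_gt this
  exact not_signAdmissible_threeHalves
    ((dictShiftPSD_iff_signAdmissible_of_ne (by norm_num) (by norm_num)
      (by norm_num [Matrix.cons_val_two, Matrix.tail_cons]) hc).1 h)

end Det

end Literature.NumberTheory.LFunctions.Zhang2022
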